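import Mathlib
import Summits.Ventures.HodgeRepro.Tier4.Common.TorusInfCompactConj
import Summits.Ventures.HodgeRepro.Tier4.Common.SettingOfData
import Summits.Ventures.HodgeRepro.Tier4.Line4.ArchSeesawBridge
import Summits.Ventures.HodgeRepro.Tier4.Line4.ArchIntegrableOfGrowth

/-!
# Tier4/Line4/ArchMatchingSeesaw — C-L4-7A-SUPPORT: the (7a) SUPPORT LEMMA at the SEESAW INSTANCE, over tree
declarations — display (7a)'s conclusion `L1Class.D3CoeffData' (seesawPlane …) S R q g g' w₀ eP eM eP' eM' γ₀ νinf νinf'`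
from the skeleton's own (7a) binders (`a`, `_ha`, `_hpos`, `g g' hgg' hg'g hgΩ`, `lam _hlam _hiso`, `R`, `eP eM eP' eM'`,
`_he`, `_he'`, `_hchi'`, `μ DG fdG compG compT compT'`, `hcm`) plus the DISPLAYED hypotheses of the support lemma: `hdef`
(the sign clause: definite at every real place `w′ ≠ w₀`), the archimedean Haar measure `μ∞` with display (8)'s
`ArchBallGrowth`, and the two prints `hF` (the `T_∞`-Fourier coefficient at the line's `γ₀`) and `hpseudo` / `hpseudo'`
(operator Schur) — for the ONE branch witness `archWitnessOf`

Blind re-derivation cell `pub-hodge-repro`, Tier 4 (README §9–§10), seat t4-L1-p5 (prover, gen 5; plan-4 g5's cut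
C-L4-7A-SUPPORT S15469 / S15485: «the support lemma ITSELF … binders = the skeleton's (7a) context (v0.40 L1300–L1334) +
`hdef` + the prints as displayed hypotheses, conclusion `L1Class.D3CoeffData' …`; v0.41 cites it by name and the (7a) sorry
stays as filed (PRINT RULE S15295)»).  Target tree path `lean/Summits/Ventures/HodgeRepro/Tier4/Line4/ArchMatchingSeesaw.lean`.
On the seat's `ArchIntegrableOfGrowth` (p708598: `d3CoeffData'_archWitness(')_of_archBallGrowth`), `ArchSeesawBridge`
(p708380: `ha1_of_pos`, `ha3_of_pos`, `he_of_he'`, `re_ne_zero_of_isReal`), typer-2's `Common/TorusInfCompactConj`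
(`compactSpace_infinitePart_subgroupOf_torusT'_seesaw`) and `Common/SettingOfData` (`Setting.ofAdelicData`); no printed input.

THE SKELETON'S VOCABULARY, UNFOLDED (the skeleton-local `abbrev`/`def`s are not on the tree — CMPlaceBridge's pattern):
`kOf E = ↥(maximalRealSubfield E)`; `seesawPlane q a g g' hgg' hg'g hgΩ = (mixedRow q (a 0) (a 2)).withTransportedTorus g g'
hgg' hg'g hgΩ` (`rfl`); `w₀ d = InfinitePlace.mk φ` with `φ = d.τ₀.comp (algebraMap (kOf E) E)`, so the skeleton's
`_hpos : ∀ i, 0 < (d.τ₀ (algebraMap (kOf E) E (a i))).re` is `∀ i, 0 < (φ (a i)).re` by `rfl` (`RingHom.comp_apply`), and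
likewise the `(d.τ₀ (algebraMap _ E lam)).re` of `_he'` is `(φ lam).re`; `hcm` is the skeleton's `hcm` (= `l4_isCMAt q _hq`);
`S = Setting.ofAdelicData W R μ DG fdG compG compT compT'`; `νinf = haarInf …`, `νinf' = haarInf' …` (Haar by
`haarInf'_isHaar`, a binder `[νinf'.IsHaarMeasure]` here).  The real-ness of `φ`: `IsTotallyReal (maximalRealSubfield E)`
(Mathlib) gives `(mk φ).IsReal`, hence `ComplexEmbedding.IsReal φ` (`isReal_mk_iff`).

THE WITNESS.  `archWitnessOf w₀ eP′ eM′ := if eP′ w₀ = eM′ w₀ + 3 then archWitness else archWitness'` — the branch is decided by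
the displayed weights (`_he`/`_he'` + `lam ≠ 0` force `eP′ w₀ − eM′ w₀ = ±3`: `he_of_he'`); the prints `hF`, `hpseudo`, `hpseudo'`
are stated for this ONE function.

WHAT IS PROVED (kernel, no print): `archWitnessOf` (def) with `archWitnessOf_of_holo` / `archWitnessOf_of_anti`;
**`d3CoeffData'_archWitnessOf_of_archBallGrowth`** (the branch-free form of `d3CoeffData'_archWitness(')_of_archBallGrowth`);
**`d3CoeffData'_seesaw`** — THE SUPPORT LEMMA: the skeleton's (7a) binders (unfolded as above) + `hdef` + `(μ∞) [Haar]
(hgrowth : ArchBallGrowth W μ∞)` + `hF` + `hpseudo` + `hpseudo'` ⊢ `L1Class.D3CoeffData' W (Setting.ofAdelicData W R μ DG fdG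
compG compT compT') R q g g' (mk φ) eP eM eP' eM' γ₀ νinf νinf'`.  Nothing here says anything about the status of the Hodge
conjecture for CM abelian varieties, which is NOT proved (HC_CM is NOT proved by anyone in this repository).
-/

set_option autoImplicit false

noncomputable section

namespace Summit.Ventures.HodgeRepro.Tier4.Line4

open Summit.Ventures.HodgeRepro.Tier4.Common Summit.Ventures.HodgeRepro.Tier4.Line1
  Summit.Ventures.HodgeRepro.Tier4.Line4.L1Class NumberField MeasureTheory Matrix

open scoped Classical

section Branch

variable {k : Type} [Field k] [NumberField k] (q : QuadData k) (a : Fin 4 → k)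
  (g g' : Matrix (Fin 4) (Fin 4) k) (hgg' : g * g' = 1) (hg'g : g' * g = 1)
  (hgΩ : g * (PlaneData.mixedRow q (a 0) (a 2)).Ω = (PlaneData.mixedRow q (a 0) (a 2)).Ω * g)
  (lam : k) (hlam : lam ≠ 0)
  (hiso : g * (PlaneData.mixedRow q (a 1) (a 3)).B * gᵀ = lam • (PlaneData.mixedRow q (a 0) (a 2)).B)
  (w₀ : InfinitePlace k) (eP' eM' : InfinitePlace k → ℤ)

/-- **the branch witness**: `archWitness` when `eP′ w₀ = eM′ w₀ + 3` (holomorphic), `archWitness'` otherwise. -/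
def archWitnessOf : GA ((PlaneData.mixedRow q (a 0) (a 2)).withTransportedTorus g g' hgg' hg'g hgΩ) → ℂ :=
  if eP' w₀ = eM' w₀ + 3 then archWitness q a g g' hgg' hg'g hgΩ lam hiso w₀ eP' eM'
  else archWitness' q a g g' hgg' hg'g hgΩ lam hiso w₀ eP' eM'

/-- the holomorphic branch. -/
theorem archWitnessOf_of_holo (h : eP' w₀ = eM' w₀ + 3) :
    archWitnessOf q a g g' hgg' hg'g hgΩ lam hiso w₀ eP' eM' = archWitness q a g g' hgg' hg'g hgΩ lam hiso w₀ eP' eM' :=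
  if_pos h

/-- the antiholomorphic branch. -/
theorem archWitnessOf_of_anti (h : ¬ eP' w₀ = eM' w₀ + 3) :
    archWitnessOf q a g g' hgg' hg'g hgΩ lam hiso w₀ eP' eM' = archWitness' q a g g' hgg' hg'g hgΩ lam hiso w₀ eP' eM' :=
  if_neg h

variable [MeasurableSpace (GA ((PlaneData.mixedRow q (a 0) (a 2)).withTransportedTorus g g' hgg' hg'g hgΩ))]
  [BorelSpace (GA ((PlaneData.mixedRow q (a 0) (a 2)).withTransportedTorus g g' hgg' hg'g hgΩ))]
  (S : RTF.Setting (GA ((PlaneData.mixedRow q (a 0) (a 2)).withTransportedTorus g g' hgg' hg'g hgΩ)))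
  (R : RTFData ((PlaneData.mixedRow q (a 0) (a 2)).withTransportedTorus g g' hgg' hg'g hgΩ))
  (eP eM : InfinitePlace k → ℤ)
  (γ₀ : GA ((PlaneData.mixedRow q (a 0) (a 2)).withTransportedTorus g g' hgg' hg'g hgΩ))
  (νinf : Measure (torusInf ((PlaneData.mixedRow q (a 0) (a 2)).withTransportedTorus g g' hgg' hg'g hgΩ)))
  (νinf' : Measure (torusInf' ((PlaneData.mixedRow q (a 0) (a 2)).withTransportedTorus g g' hgg' hg'g hgΩ)))

include hlam in
/-- **`D3CoeffData'` for the branch witness from the ball growth**: the branch-free form of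
`d3CoeffData'_archWitness(')_of_archBallGrowth` (the case split on `eP′ w₀ = eM′ w₀ + 3`). -/
theorem d3CoeffData'_archWitnessOf_of_archBallGrowth [S.μ.IsHaarMeasure]
    (μinf : Measure (infinitePart ((PlaneData.mixedRow q (a 0) (a 2)).withTransportedTorus g g' hgg' hg'g hgΩ)))
    [μinf.IsHaarMeasure]
    (hgrowth : ArchBallGrowth ((PlaneData.mixedRow q (a 0) (a 2)).withTransportedTorus g g' hgg' hg'g hgΩ) μinf)
    [CompactSpace (torusInf' ((PlaneData.mixedRow q (a 0) (a 2)).withTransportedTorus g g' hgg' hg'g hgΩ))]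
    [νinf'.IsHaarMeasure]
    (hall : ∀ w : InfinitePlace k, w.IsReal ∧ IsCMAt q w)
    (ha1 : 0 < (adToC w₀ (algebraMap k (Ad k) (a 1))).re) (ha3 : (adToC w₀ (algebraMap k (Ad k) (-1 * a 3))).re < 0)
    (hdef : ∀ w' : InfinitePlace k, w' ≠ w₀ → w'.IsReal ∧ IsCMAt q w' ∧
      0 < (adToC w' (algebraMap k (Ad k) (a 1))).re * (adToC w' (algebraMap k (Ad k) (-1 * a 3))).re)
    (he : eP' w₀ = eM' w₀ + 3 ∨ eM' w₀ = eP' w₀ + 3)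
    (hchi' : ∀ w : InfinitePlace k, ChiMatchesAt' ((PlaneData.mixedRow q (a 0) (a 2)).withTransportedTorus g g' hgg' hg'g hgΩ)
      q w g g' (eP' w) (eM' w) R.chi')
    (hF : (∫ t : torusInf ((PlaneData.mixedRow q (a 0) (a 2)).withTransportedTorus g g' hgg' hg'g hgΩ),
        R.chi t * archWitnessOf q a g g' hgg' hg'g hgΩ lam hiso w₀ eP' eM'
          (((t : torusT ((PlaneData.mixedRow q (a 0) (a 2)).withTransportedTorus g g' hgg' hg'g hgΩ)) :
            GA ((PlaneData.mixedRow q (a 0) (a 2)).withTransportedTorus g g' hgg' hg'g hgΩ))⁻¹ * γ₀) ∂νinf) ≠ 0)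
    (hpseudo : ∀ ffin : GA ((PlaneData.mixedRow q (a 0) (a 2)).withTransportedTorus g g' hgg' hg'g hgΩ) → ℂ,
      L1Class.IsFinFactor ((PlaneData.mixedRow q (a 0) (a 2)).withTransportedTorus g g' hgg' hg'g hgΩ) ffin →
      IsPseudoCoeffAt ((PlaneData.mixedRow q (a 0) (a 2)).withTransportedTorus g g' hgg' hg'g hgΩ) S q w₀ eP eM
        (RTF.cj (L1Class.prodFn ((PlaneData.mixedRow q (a 0) (a 2)).withTransportedTorus g g' hgg' hg'g hgΩ)
          (archWitnessOf q a g g' hgg' hg'g hgΩ lam hiso w₀ eP' eM') ffin)))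
    (hpseudo' : ∀ ffin : GA ((PlaneData.mixedRow q (a 0) (a 2)).withTransportedTorus g g' hgg' hg'g hgΩ) → ℂ,
      L1Class.IsFinFactor ((PlaneData.mixedRow q (a 0) (a 2)).withTransportedTorus g g' hgg' hg'g hgΩ) ffin →
      IsPseudoCoeffAt' ((PlaneData.mixedRow q (a 0) (a 2)).withTransportedTorus g g' hgg' hg'g hgΩ) S q g g' w₀ eP' eM'
        (RTF.cj (L1Class.prodFn ((PlaneData.mixedRow q (a 0) (a 2)).withTransportedTorus g g' hgg' hg'g hgΩ)
          (archWitnessOf q a g g' hgg' hg'g hgΩ lam hiso w₀ eP' eM') ffin))) :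
    L1Class.D3CoeffData' ((PlaneData.mixedRow q (a 0) (a 2)).withTransportedTorus g g' hgg' hg'g hgΩ) S R q g g' w₀
      eP eM eP' eM' γ₀ νinf νinf' := by
  by_cases h : eP' w₀ = eM' w₀ + 3
  · rw [archWitnessOf_of_holo q a g g' hgg' hg'g hgΩ lam hiso w₀ eP' eM' h] at hF hpseudo hpseudo'
    exact d3CoeffData'_archWitness_of_archBallGrowth q a g g' hgg' hg'g hgΩ lam hlam hiso S R w₀ eP eM eP' eM' γ₀ νinf
      νinf' μinf hgrowth hall ha1 ha3 hdef h hchi' hF hpseudo hpseudo'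
  · have h' : eM' w₀ = eP' w₀ + 3 := he.resolve_left h
    rw [archWitnessOf_of_anti q a g g' hgg' hg'g hgΩ lam hiso w₀ eP' eM' h] at hF hpseudo hpseudo'
    exact d3CoeffData'_archWitness'_of_archBallGrowth q a g g' hgg' hg'g hgΩ lam hlam hiso S R w₀ eP eM eP' eM' γ₀ νinf
      νinf' μinf hgrowth hall ha1 ha3 hdef h' hchi' hF hpseudo hpseudo'

end Branch

section Seesaw

variable {E : Type} [Field E] [NumberField E]

/-- **THE (7a) SUPPORT LEMMA AT THE SEESAW INSTANCE** (C-L4-7A-SUPPORT): over `k = E⁺ = ↥(maximalRealSubfield E)`, the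
place `w₀ = InfinitePlace.mk φ` below a real embedding `φ` (the skeleton's `d.τ₀.comp (algebraMap (kOf E) E)`), the seesaw
plane `(mixedRow q (a 0) (a 2)).withTransportedTorus g g' hgg' hg'g hgΩ` (= `seesawPlane …` by `rfl`), the skeleton's (7a)
binders `_ha _hpos _hlam _hiso R eP eM eP' eM' _he _he' _hchi' μ DG fdG compG compT compT' hcm` in their own shapes, the
Haar pair `νinf νinf'` (`[νinf'.IsHaarMeasure]` = `haarInf'_isHaar`), and the DISPLAYED hypotheses `hdef` (the sign clause
of definiteness at every real place `w′ ≠ w₀`), `μ∞` + `ArchBallGrowth` (display (8)'s print), `hF`, `hpseudo`, `hpseudo'`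
(prints) ⊢ `L1Class.D3CoeffData' … (Setting.ofAdelicData …) R q g g' (mk φ) eP eM eP' eM' γ₀ νinf νinf'`
for the line's `γ₀`.  By name: `hall` from `IsTotallyReal.isReal` + `hcm`; `ha1`/`ha3` from `_hpos` (`ha1_of_pos`,
`ha3_of_pos`); the branch from `_he`/`_he'` (`he_of_he'`, `re_ne_zero_of_isReal`); `[CompactSpace T′_∞]` from
`compactSpace_infinitePart_subgroupOf_torusT'_seesaw`; `[S.μ.IsHaarMeasure]` by `inferInstanceAs`. -/
theorem d3CoeffData'_seesaw (q : QuadData ↥(maximalRealSubfield E)) (a : Fin 4 → ↥(maximalRealSubfield E))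
    (_ha : ∀ i, a i ≠ 0) (φ : ↥(maximalRealSubfield E) →+* ℂ) (_hpos : ∀ i, 0 < (φ (a i)).re)
    (g g' : Matrix (Fin 4) (Fin 4) ↥(maximalRealSubfield E)) (hgg' : g * g' = 1) (hg'g : g' * g = 1)
    (hgΩ : g * (PlaneData.mixedRow q (a 0) (a 2)).Ω = (PlaneData.mixedRow q (a 0) (a 2)).Ω * g)
    (lam : ↥(maximalRealSubfield E)) (_hlam : lam ≠ 0)
    (_hiso : g * (PlaneData.mixedRow q (a 1) (a 3)).B * gᵀ = lam • (PlaneData.mixedRow q (a 0) (a 2)).B)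
    [MeasurableSpace (GA ((PlaneData.mixedRow q (a 0) (a 2)).withTransportedTorus g g' hgg' hg'g hgΩ))]
    [BorelSpace (GA ((PlaneData.mixedRow q (a 0) (a 2)).withTransportedTorus g g' hgg' hg'g hgΩ))]
    (R : RTFData ((PlaneData.mixedRow q (a 0) (a 2)).withTransportedTorus g g' hgg' hg'g hgΩ))
    [R.μT.IsHaarMeasure] [R.μT'.IsHaarMeasure]
    (eP eM eP' eM' : InfinitePlace ↥(maximalRealSubfield E) → ℤ)
    (_he : eP (InfinitePlace.mk φ) - eM (InfinitePlace.mk φ) = 3 ∨ eP (InfinitePlace.mk φ) - eM (InfinitePlace.mk φ) = -3)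
    (_he' : (0 < (φ lam).re → eP' (InfinitePlace.mk φ) - eM' (InfinitePlace.mk φ) =
        eP (InfinitePlace.mk φ) - eM (InfinitePlace.mk φ)) ∧
      ((φ lam).re < 0 → eP' (InfinitePlace.mk φ) - eM' (InfinitePlace.mk φ) =
        -(eP (InfinitePlace.mk φ) - eM (InfinitePlace.mk φ))))
    (_hchi' : ∀ w : InfinitePlace ↥(maximalRealSubfield E),
      ChiMatchesAt' ((PlaneData.mixedRow q (a 0) (a 2)).withTransportedTorus g g' hgg' hg'g hgΩ) q w g g' (eP' w) (eM' w)
        R.chi')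
    (μ : Measure (GA ((PlaneData.mixedRow q (a 0) (a 2)).withTransportedTorus g g' hgg' hg'g hgΩ))) [μ.IsHaarMeasure]
    (DG : Set (GA ((PlaneData.mixedRow q (a 0) (a 2)).withTransportedTorus g g' hgg' hg'g hgΩ)))
    (fdG : IsFundamentalDomain (rationalPoints ((PlaneData.mixedRow q (a 0) (a 2)).withTransportedTorus g g' hgg' hg'g hgΩ))
      DG μ)
    (compG : IsCompact (closure DG)) (compT : IsCompact (closure R.DT)) (compT' : IsCompact (closure R.DT'))
    (hcm : ∀ w : InfinitePlace ↥(maximalRealSubfield E), IsCMAt q w)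
    (hdef : ∀ w' : InfinitePlace ↥(maximalRealSubfield E), w' ≠ InfinitePlace.mk φ →
      0 < (adToC w' (algebraMap _ (Ad ↥(maximalRealSubfield E)) (a 1))).re *
        (adToC w' (algebraMap _ (Ad ↥(maximalRealSubfield E)) (-1 * a 3))).re)
    (γ₀ : GA ((PlaneData.mixedRow q (a 0) (a 2)).withTransportedTorus g g' hgg' hg'g hgΩ))
    (νinf : Measure (torusInf ((PlaneData.mixedRow q (a 0) (a 2)).withTransportedTorus g g' hgg' hg'g hgΩ)))
    (νinf' : Measure (torusInf' ((PlaneData.mixedRow q (a 0) (a 2)).withTransportedTorus g g' hgg' hg'g hgΩ)))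
    [νinf'.IsHaarMeasure]
    (μinf : Measure (infinitePart ((PlaneData.mixedRow q (a 0) (a 2)).withTransportedTorus g g' hgg' hg'g hgΩ)))
    [μinf.IsHaarMeasure]
    (hgrowth : ArchBallGrowth ((PlaneData.mixedRow q (a 0) (a 2)).withTransportedTorus g g' hgg' hg'g hgΩ) μinf)
    (hF : (∫ t : torusInf ((PlaneData.mixedRow q (a 0) (a 2)).withTransportedTorus g g' hgg' hg'g hgΩ),
        R.chi t * archWitnessOf q a g g' hgg' hg'g hgΩ lam _hiso (InfinitePlace.mk φ) eP' eM'
          (((t : torusT ((PlaneData.mixedRow q (a 0) (a 2)).withTransportedTorus g g' hgg' hg'g hgΩ)) :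
            GA ((PlaneData.mixedRow q (a 0) (a 2)).withTransportedTorus g g' hgg' hg'g hgΩ))⁻¹ * γ₀) ∂νinf) ≠ 0)
    (hpseudo : ∀ ffin : GA ((PlaneData.mixedRow q (a 0) (a 2)).withTransportedTorus g g' hgg' hg'g hgΩ) → ℂ,
      L1Class.IsFinFactor ((PlaneData.mixedRow q (a 0) (a 2)).withTransportedTorus g g' hgg' hg'g hgΩ) ffin →
      IsPseudoCoeffAt ((PlaneData.mixedRow q (a 0) (a 2)).withTransportedTorus g g' hgg' hg'g hgΩ)
        (Setting.ofAdelicData ((PlaneData.mixedRow q (a 0) (a 2)).withTransportedTorus g g' hgg' hg'g hgΩ) R μ DG fdG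
          compG compT compT') q (InfinitePlace.mk φ) eP eM
        (RTF.cj (L1Class.prodFn ((PlaneData.mixedRow q (a 0) (a 2)).withTransportedTorus g g' hgg' hg'g hgΩ)
          (archWitnessOf q a g g' hgg' hg'g hgΩ lam _hiso (InfinitePlace.mk φ) eP' eM') ffin)))
    (hpseudo' : ∀ ffin : GA ((PlaneData.mixedRow q (a 0) (a 2)).withTransportedTorus g g' hgg' hg'g hgΩ) → ℂ,
      L1Class.IsFinFactor ((PlaneData.mixedRow q (a 0) (a 2)).withTransportedTorus g g' hgg' hg'g hgΩ) ffin →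
      IsPseudoCoeffAt' ((PlaneData.mixedRow q (a 0) (a 2)).withTransportedTorus g g' hgg' hg'g hgΩ)
        (Setting.ofAdelicData ((PlaneData.mixedRow q (a 0) (a 2)).withTransportedTorus g g' hgg' hg'g hgΩ) R μ DG fdG
          compG compT compT') q g g' (InfinitePlace.mk φ) eP' eM'
        (RTF.cj (L1Class.prodFn ((PlaneData.mixedRow q (a 0) (a 2)).withTransportedTorus g g' hgg' hg'g hgΩ)
          (archWitnessOf q a g g' hgg' hg'g hgΩ lam _hiso (InfinitePlace.mk φ) eP' eM') ffin))) :
    L1Class.D3CoeffData' ((PlaneData.mixedRow q (a 0) (a 2)).withTransportedTorus g g' hgg' hg'g hgΩ)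
      (Setting.ofAdelicData ((PlaneData.mixedRow q (a 0) (a 2)).withTransportedTorus g g' hgg' hg'g hgΩ) R μ DG fdG
        compG compT compT') R q g g' (InfinitePlace.mk φ) eP eM eP' eM' γ₀ νinf νinf' := by
  have hreal : ∀ w : InfinitePlace ↥(maximalRealSubfield E), w.IsReal := fun w => IsTotallyReal.isReal w
  have hφ : ComplexEmbedding.IsReal φ := InfinitePlace.isReal_mk_iff.1 (hreal (InfinitePlace.mk φ))
  have hall : ∀ w : InfinitePlace ↥(maximalRealSubfield E), w.IsReal ∧ IsCMAt q w := fun w => ⟨hreal w, hcm w⟩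
  have hdef' : ∀ w' : InfinitePlace ↥(maximalRealSubfield E), w' ≠ InfinitePlace.mk φ → w'.IsReal ∧ IsCMAt q w' ∧
      0 < (adToC w' (algebraMap _ (Ad ↥(maximalRealSubfield E)) (a 1))).re *
        (adToC w' (algebraMap _ (Ad ↥(maximalRealSubfield E)) (-1 * a 3))).re :=
    fun w' hw' => ⟨hreal w', hcm w', hdef w' hw'⟩
  haveI : CompactSpace (torusInf' ((PlaneData.mixedRow q (a 0) (a 2)).withTransportedTorus g g' hgg' hg'g hgΩ)) :=
    compactSpace_infinitePart_subgroupOf_torusT'_seesaw q a g g' hgg' hg'g hgΩ lam _hlam _hiso (_ha 1) (_ha 3) hreal hcm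
  haveI : (Setting.ofAdelicData ((PlaneData.mixedRow q (a 0) (a 2)).withTransportedTorus g g' hgg' hg'g hgΩ) R μ DG fdG
      compG compT compT').μ.IsHaarMeasure := inferInstanceAs (μ.IsHaarMeasure)
  exact d3CoeffData'_archWitnessOf_of_archBallGrowth q a g g' hgg' hg'g hgΩ lam _hlam _hiso (InfinitePlace.mk φ) eP' eM'
    _ R eP eM γ₀ νinf νinf' μinf hgrowth hall (ha1_of_pos φ hφ a _hpos) (ha3_of_pos φ hφ a _hpos) hdef'
    (he_of_he' (re_ne_zero_of_isReal φ hφ _hlam) _he _he') _hchi' hF hpseudo hpseudo'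

end Seesaw

end Summit.Ventures.HodgeRepro.Tier4.Line4

end
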